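import Mathlib
import HarnessLib
import Literature.Analysis.FluidPDE.BoundedAnnihilator
import Summits.NavierStokesRegularity.NavierStokesRegularity.Theorems.UnthreadedRigidityDoorUnthreadedRigidityThreadingJetsDefs

/-!
# Route `UnthreadedRigidityDoor`, item `UnthreadedRigidity` (W2, stmt-NavierStokesRegularity-27585) — THREADING JETS, GAUGE:
# the decaying solution of the slice pressure Poisson equation is UNIQUE (Liouville), the gauge step of the ORDER-TWO SLICE LAW

Seat ns-crc-p1 g8 (director-ns dss_146 (1): «crc-p1 lands the gauge lemma — decaying harmonic difference ⇒ 0 ⇒ p₀ = Newtonian pressure of the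
slice — as a stand-alone S–M tool both halves of `orderTwoSliceLaw_holds` import»), `--supports stmt-NavierStokesRegularity-27585 --as helper`.

THE POINT.  The slice statements `OrderTwoSliceLaw` / `HornSliceIdentityTwo` (`…ThreadingJetsDefs`, p704398) carry the pressure slice `p₀` only
through: `p₀` smooth, `Δp₀ = −div((u₀·∇)u₀)`, `p₀ → 0` at infinity.  The L-hand computes with an EXPLICIT candidate `q` (the multipole /
Newtonian pressure of the explicit shell, VIRIAL HORN card §2) having the same Laplacian and the same decay; this file supplies the one-line
passage `p₀ = q`:

* `bounded_of_tendsto_cocompact` — a continuous function tending to `0` at infinity is bounded;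
* ★ `eq_of_laplacian_eq_of_tendsto_cocompact` — two `C²` functions on `ℝ³` with the same Laplacian, both tending to `0` along `cocompact ℝ³`,
  are EQUAL (their difference is harmonic on `ℝ³` and bounded, hence constant by Liouville — the tree's
  `InnerProductSpace.HarmonicOnNhd.apply_eq_apply_of_abs_le` (`BoundedAnnihilator`) — and the constant is the limit `0`);
* `slicePressure_eq_of_decaying` — the slice-law-shaped corollary: under the pressure hypotheses of `OrderTwoSliceLaw` (`p₀` smooth,
  `Δp₀ = −div((u₀·∇)u₀)`, `p₀ → 0`), any `C²` candidate `q` with `Δq = −div((u₀·∇)u₀)` and `q → 0` IS `p₀`;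
* `fluxJetTwo_congr_pressure` — consequently the formal second jet may be evaluated with the candidate: `fluxJetTwo u₀ p₀ = fluxJetTwo u₀ q`.

HONEST FRAMING: a potential-theoretic bookkeeping step (Liouville) for the L-part of one RUNG line's bridges; nothing here bears on
`UnthreadedRigidity` (27585), the door Target, W2 or Navier–Stokes regularity; no summit statement is proved.  MODEL/rung work.
[cite: GilbargTrudinger2001, Thm 2.1]
-/

noncomputable section

-- the summit and its single sub-problem share the name (CONVENTIONS §1), as in every Theorems file
set_option linter.dupNamespace false

namespace Summit.NavierStokesRegularity.NavierStokesRegularity.Theorems.UnthreadedRigidity.ThreadingJets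

open Set Function Filter Topology InnerProductSpace
open scoped Laplacian ContDiff
open Literature.Analysis.FluidPDE
open Summit.NavierStokesRegularity.NavierStokesRegularity.Theorems.UnthreadedRigidity.ProfileHorn (E3)

/-- A continuous real function on `ℝ³` tending to `0` at infinity is bounded. [folklore] -/
theorem bounded_of_tendsto_cocompact {η : E3 → ℝ} (hc : Continuous η) (h0 : Tendsto η (cocompact E3) (𝓝 0)) :
    ∃ M : ℝ, ∀ x, |η x| ≤ M := by
  have hev : ∀ᶠ x in cocompact E3, |η x| < 1 := by
    have h := h0.eventually (Metric.ball_mem_nhds (0 : ℝ) one_pos)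
    filter_upwards [h] with x hx
    simpa [Real.dist_eq] using hx
  obtain ⟨K, hK, hKsub⟩ := mem_cocompact.1 hev
  obtain ⟨M₁, hM₁⟩ : ∃ M₁ : ℝ, ∀ x ∈ K, |η x| ≤ M₁ := by
    obtain ⟨M₁, hM₁⟩ := hK.exists_bound_of_continuousOn hc.continuousOn
    exact ⟨M₁, fun x hx => by simpa [Real.norm_eq_abs] using hM₁ x hx⟩
  refine ⟨max M₁ 1, fun x => ?_⟩
  by_cases hx : x ∈ K
  · exact (hM₁ x hx).trans (le_max_left _ _)
  · exact (le_of_lt (hKsub hx)).trans (le_max_right _ _)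

/-- ★ **Uniqueness of the decaying solution of the Poisson equation (Liouville gauge).**  Two `C²` functions on `ℝ³` with the same Laplacian
which both tend to `0` at infinity coincide: the difference is harmonic on all of `ℝ³` and bounded, hence constant
(`InnerProductSpace.HarmonicOnNhd.apply_eq_apply_of_abs_le`), and the constant is its limit `0` along the (nontrivial) cocompact filter.
[cite: GilbargTrudinger2001, Thm 2.1] -/
theorem eq_of_laplacian_eq_of_tendsto_cocompact {p q : E3 → ℝ} (hp : ContDiff ℝ 2 p) (hq : ContDiff ℝ 2 q)
    (hΔ : ∀ x, (Δ p) x = (Δ q) x) (hp0 : Tendsto p (cocompact E3) (𝓝 0)) (hq0 : Tendsto q (cocompact E3) (𝓝 0)) :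
    p = q := by
  set η : E3 → ℝ := p - q with hη_def
  -- `η` is harmonic on `ℝ³`
  have hharm : HarmonicOnNhd η univ := by
    intro x _
    refine ⟨(hp.sub hq).contDiffAt, ?_⟩
    refine Eventually.of_forall fun y => ?_
    show (Δ (p - q)) y = 0
    rw [hp.contDiffAt.laplacian_sub hq.contDiffAt, hΔ y, sub_self]
  -- `η → 0` at infinity, hence bounded
  have hη0 : Tendsto η (cocompact E3) (𝓝 0) := by
    have := hp0.sub hq0
    rwa [sub_zero] at this
  obtain ⟨M, hM⟩ := bounded_of_tendsto_cocompact (hp.continuous.sub hq.continuous) hη0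
  -- Liouville: `η` is constant, and the constant is `0`
  have hconst : ∀ x, η x = η 0 := fun x => hharm.apply_eq_apply_of_abs_le hM x 0
  have hlim : Tendsto (fun _ : E3 => η 0) (cocompact E3) (𝓝 0) := hη0.congr fun x => hconst x
  haveI : (cocompact E3).NeBot := inferInstance
  have hc0 : η 0 = 0 := tendsto_nhds_unique tendsto_const_nhds hlim
  funext x
  have := hconst x
  rw [hc0] at this
  exact sub_eq_zero.1 this


/-- **The slice pressure is the decaying candidate** (the corollary in the shape of the pressure hypotheses of `OrderTwoSliceLaw` /
`HornSliceIdentityTwo`): if `p₀` is smooth with `Δp₀ = −div((u₀·∇)u₀)` and `p₀ → 0` at infinity, then every `C²` candidate `q` with the same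
Poisson datum and the same decay IS `p₀`.  (The L-hand takes for `q` the explicit multipole pressure of the shell.) [folklore] -/
theorem slicePressure_eq_of_decaying {u₀ : E3 → E3} {p₀ q : E3 → ℝ} (hp : ContDiff ℝ (⊤ : ℕ∞) p₀)
    (hpoi : ∀ x : E3, (Δ p₀) x = -VectorCalculus.divergence (convect u₀ u₀) x)
    (hdec : Tendsto p₀ (cocompact E3) (𝓝 0)) (hq : ContDiff ℝ 2 q)
    (hqpoi : ∀ x : E3, (Δ q) x = -VectorCalculus.divergence (convect u₀ u₀) x)
    (hqdec : Tendsto q (cocompact E3) (𝓝 0)) : p₀ = q :=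
  eq_of_laplacian_eq_of_tendsto_cocompact (hp.of_le (by norm_cast)) hq (fun x => by rw [hpoi, hqpoi]) hdec hqdec

/-- The Navier–Stokes tendency sees the pressure slice only through its gradient. [folklore] -/
theorem nsTendency_congr_of_gradient_eq {v : E3 → E3} {p q : E3 → ℝ} (h : ∀ z, gradient p z = gradient q z) :
    nsTendency v p = nsTendency v q := by
  funext z
  simp only [nsTendency, h z]

/-- The formal second jet sees the pressure slice only through its gradient (gauge by constants is free). [folklore] -/
theorem fluxJetTwo_congr_of_gradient_eq {v : E3 → E3} {p q : E3 → ℝ} (h : ∀ z, gradient p z = gradient q z) (x₀ x : E3) :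
    fluxJetTwo v p x₀ x = fluxJetTwo v q x₀ x := by
  simp only [fluxJetTwo, nsTendency_congr_of_gradient_eq h]

/-- The formal second jet of the slice may be evaluated with the decaying candidate pressure. [folklore] -/
theorem fluxJetTwo_eq_of_decaying {u₀ : E3 → E3} {p₀ q : E3 → ℝ} (hp : ContDiff ℝ (⊤ : ℕ∞) p₀)
    (hpoi : ∀ x : E3, (Δ p₀) x = -VectorCalculus.divergence (convect u₀ u₀) x)
    (hdec : Tendsto p₀ (cocompact E3) (𝓝 0)) (hq : ContDiff ℝ 2 q)
    (hqpoi : ∀ x : E3, (Δ q) x = -VectorCalculus.divergence (convect u₀ u₀) x)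
    (hqdec : Tendsto q (cocompact E3) (𝓝 0)) (x₀ x : E3) :
    fluxJetTwo u₀ p₀ x₀ x = fluxJetTwo u₀ q x₀ x := by
  rw [slicePressure_eq_of_decaying hp hpoi hdec hq hqpoi hqdec]

end Summit.NavierStokesRegularity.NavierStokesRegularity.Theorems.UnthreadedRigidity.ThreadingJets

end
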